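import Summits.BirchSwinnertonDyer.BirchSwinnertonDyer.Theorems.EisensteinPrimesMazurMCOnCellBTwistbackTwistDoor
import HarnessLib

/-!
# Crux 3 `MazurMCOnCellB` (stmt-BirchSwinnertonDyer-19033), line `twistback` v4 — the TWIST DOOR FROM THE
# `W`-SIDE, part 2: the SECOND X2b shape (carrier `Wd/Ψ₀`) and the COMPOSITION with the door — stub 6's
# conclusion at a non-split X2b pair from the line datum of `W`, an admissible `K`, two units, the balance of `W`

Width seat bsd-line-x2-p1-w3 (gen 9), cell `bsd-eis` (run/shared/lean/pub/bsd-eis/), 2026-08-28. HONEST FRAMING: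
THEOREMS ONLY (no `def`, no named fact introduced, no `sorry`); `--supports` stmt-BirchSwinnertonDyer-19033; closes no
stub by itself; §2 is CONDITIONAL on the named facts of `…TwistbackKLFlatPartner` §3 (`PublishedInputs`, Disegni
Thm. 4(1), GV Thm. (3.11)); no summit statement, no Mazur main conjecture and no BSD is proved for any curve; 0 cells /
labels / tiers move.

* §1 `klFlatCarrier_twist_of_lineUnramifiedEven` — SECOND X2b SHAPE (line of `W` UNRAMIFIED at `p` and EVEN, `W`
  multiplicative at `p`): every globally minimal model `Wd` of `W^{(d_K)}` satisfies the carrier clause `hKL` of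
  `upperPartner_at_of_klFlat_partner` with `V′ = Wd/Ψ₀` (part 2's door form
  `exists_isogenous_twistLine_ramifiedEven_characters`, Tate facts DISCHARGED by the tree's
  `Silverman1994_thmV53_tateUniformisation_holds` / `Silverman1994_thmV53_corV54_tateUniformisation_holds`),
  `S₀′ = S₀ ∪ {v : ℓ_v ∣ d_K}`, characters `(ψχ̄, φχ̄)`; `δ` and good reduction moved along the isogeny (part 1 of
  this door, `delta_eq_of_isIsogenous`; tree `IsIsogenous.hasGoodReductionAt_iff_of_isIsogenous`).
* §2 `upperPartner_at_of_klFlat_twist_of_lineRamifiedOdd` / `…_of_lineUnramifiedEven` — the COMPOSITION: stub 6's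
  conclusion AT a non-split X2b pair `(W, p)` (verbatim shape of p645525 §3) from ONE admissible `K` (Heegner for
  `N_W` and `p`, `d_K` odd `< −4`, `r_an(W^{(d_K)}) = 1`), the line datum of `W` with primitive characters, the two
  units of the twisted characters and the balance `1 + Σ_{S₀} δ_W = Σ_{S₀} s([φ=ℓ̄]+[ψ=ℓ̄])` over the bad places
  `S₀ ∌ (p)` of `W` — the door `upperPartner_at_of_klFlat_partner` with its `hKL` DISCHARGED by the twist door.

References: [GreenbergVatsal2000] Thm. (1.3), §2 p. 28, Prop. (2.4), §3 Thm. (3.11), (28); [SilvermanAEC2009] X.5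
Cor. 5.4, Cor. VII.7.2; [SilvermanATAEC1994] IV.9.4, Thm. V.5.3, Cor. V.5.4; [Knapp1993] Thm. 11.67; [Disegni2020]
Thm. 4; [Wuthrich2014] Thm. 16; [KrizLi2019] §4 (the supply of `K`; not used).
-/

set_option autoImplicit false

-- `Summit.BirchSwinnertonDyer.BirchSwinnertonDyer.…`: the summit and its single sub-problem share a name.
set_option linter.dupNamespace false

noncomputable section

open scoped Classical NumberTheorySymbols

open WeierstrassCurve NumberField IsDedekindDomain Field DirichletCharacter
  Literature.NumberTheory.EllipticCurves Literature.NumberTheory.GaloisRepresentations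
  Literature.NumberTheory.EllipticCurves.GreenbergVatsal2000
  Literature.NumberTheory.EllipticCurves.Rank1Residual
  Literature.NumberTheory.QuadraticFields Literature.NumberTheory.QuadraticFields.Quadratic
  Summit.BirchSwinnertonDyer.Rank1Residual Summit.BirchSwinnertonDyer.Rank1Residual.X2
  Summit.BirchSwinnertonDyer.BirchSwinnertonDyer.Theorems.EisensteinPrimesMazurMCOnCellBTwistbackTwistLineCharacters
  Summit.BirchSwinnertonDyer.BirchSwinnertonDyer.Theorems.EisensteinPrimesMazurMCOnCellBTwistbackTwistLineCharactersPackage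
  Summit.BirchSwinnertonDyer.BirchSwinnertonDyer.Theorems.EisensteinPrimesMazurMCOnCellBTwistbackQuadraticRadical
  Summit.BirchSwinnertonDyer.BirchSwinnertonDyer.Theorems.EisensteinPrimesMazurMCOnCellBTwistbackTwistLocalBalance
  Summit.BirchSwinnertonDyer.BirchSwinnertonDyer.Theorems.EisensteinPrimesMazurMCOnCellBTwistbackKLFlatPartner
  Summit.BirchSwinnertonDyer.BirchSwinnertonDyer.Theorems.EisensteinPrimesMazurMCOnCellBTwistbackTwistDoor
  Literature.NumberTheory.EllipticCurves.Rank1Residual.Typed Literature.NumberTheory.EllipticCurves.Disegni2020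
  Summit.BirchSwinnertonDyer.BirchSwinnertonDyer.Theses

namespace Summit.BirchSwinnertonDyer.BirchSwinnertonDyer.Theorems.EisensteinPrimesMazurMCOnCellBTwistbackTwistDoorIsogenous

/-! ## §1. Second X2b shape: the line of `W` UNRAMIFIED-EVEN — the carrier is the `p`-isogenous curve `Wd/Ψ₀` -/

/-- **The KL-flat carrier clause of the door AT THE TWIST, SECOND X2b SHAPE (the line of `W` is UNRAMIFIED at `p`
and EVEN; `W` globally minimal and MULTIPLICATIVE at `p`).** Same data as `klFlatCarrier_twist_of_lineRamifiedOdd`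
with `p ∤ m`, `p ∣ d`, and the two units now read at the SWAPPED twisted characters: `‖L_∅(C,0)‖ = 1` for `ψχ̄`
(mod `d|d_K|`, the line character of the carrier) and `‖L_∅(D,0)‖ = 1` for `φχ̄` (mod `m|d_K|`, its quotient
character). Conclusion: EVERY globally minimal model `Wd` of `W^{(d_K)}` satisfies the carrier clause of
`…TwistbackKLFlatPartner` §3 `hKL` (with `n` for `1`) with the carrier `V′ = Wd/Ψ₀` of part 2's door form
(`exists_isogenous_twistLine_ramifiedEven_characters`; the Tate-uniformisation facts are DISCHARGED by the tree's
`Silverman1994_thmV53_tateUniformisation_holds`, `Silverman1994_thmV53_corV54_tateUniformisation_holds`; `Wd` is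
multiplicative at `p` because `p` splits in `K`), `S₀′ = S₀ ∪ {v : ℓ_v ∣ d_K}`, characters `(ψχ̄, φχ̄)`; the
`S₀′`-clauses and the balance are those of `Wd` (§2) moved along the isogeny (`δ` and good reduction are isogeny
invariants, §1 and tree `IsIsogenous.hasGoodReductionAt_iff_of_isIsogenous`). No main conjecture / BSD is proved here.
[cite: GreenbergVatsal2000, Thm. (1.3), §2 p. 28 (E′ = E/Φ), Prop. (2.4), §3 (28)] [cite: SilvermanAEC2009, X.5 Cor. 5.4, Cor. VII.7.2]
[cite: SilvermanATAEC1994, IV.9.4, Thm. V.5.3, Cor. V.5.4] [cite: Knapp1993, Thm. 11.67] [cite: Cox2013, §1.C Lemma 1.14] -/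
theorem klFlatCarrier_twist_of_lineUnramifiedEven
    (W : WeierstrassCurve ℚ) [W.IsElliptic] [W.IsGloballyMinimal] {p : ℕ} [Fact p.Prime] (hp2 : p ≠ 2)
    (hmult : W.HasMultiplicativeReductionAtPrime p)
    (K : Type) [Field K] [NumberField K] (hK : IsImaginaryQuadratic K) (hodd : Odd (NumberField.discr K))
    [NeZero (NumberField.discr K).natAbs]
    {N₀ : ℕ} (hHN : SatisfiesHeegnerHypothesis N₀ K) (hHp : SatisfiesHeegnerHypothesis p K)
    (χ : MulChar (ZMod (NumberField.discr K).natAbs) ℤ)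
    (hχJ : ∀ a : ℕ, χ (a : ZMod (NumberField.discr K).natAbs) = J((a : ℤ) | (NumberField.discr K).natAbs))
    {Φ₀ : AddSubgroup (geomTorsion W (p : ℤ))} (hΦ : IsRationalLine W p Φ₀)
    (hunr : LineUnramifiedAt W p Φ₀) (hevenL : LineEven W p Φ₀)
    {m : ℕ} [NeZero m] (φ : DirichletCharacter (ZMod p) m) {d : ℕ} [NeZero d]
    (ψ : DirichletCharacter (ZMod p) d) (hφ : φ.IsPrimitive) (hψ : ψ.IsPrimitive) (hpm : ¬ p ∣ m)
    (hpd : p ∣ d) (hmD : m.Coprime (NumberField.discr K).natAbs)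
    (hdD : d.Coprime (NumberField.discr K).natAbs)
    (hφ0 : ∀ (σ : absoluteGaloisGroup ℚ), ∀ P ∈ Φ₀,
      σ • P = (φ ((modNCyclotomicCharacter ℚ m σ : (ZMod m)ˣ) : ZMod m)).val • P)
    (hψ0 : ∀ (σ : absoluteGaloisGroup ℚ) (P : geomTorsion W (p : ℤ)),
      σ • P - (ψ ((modNCyclotomicCharacter ℚ d σ : (ZMod d)ˣ) : ZMod d)).val • P ∈ Φ₀)
    (S₀ : Finset (HeightOneSpectrum (𝓞 ℚ))) (hS₀p : ∀ v ∈ S₀, ((p : ℕ) : 𝓞 ℚ) ∉ v.asIdeal)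
    (hS₀N : ∀ v ∈ S₀, Rat.HeightOneSpectrum.natGenerator v ∣ N₀)
    (hS : ∀ v : HeightOneSpectrum (𝓞 ℚ), v ∉ S₀ → ((p : ℕ) : 𝓞 ℚ) ∉ v.asIdeal → W.HasGoodReductionAt v)
    (hC1 : ‖characterLValueC p (changeLevel (dvd_mul_right d (NumberField.discr K).natAbs) ψ *
          changeLevel (dvd_mul_left (NumberField.discr K).natAbs d)
            (χ.ringHomComp (Int.castRingHom (ZMod p))) :
        DirichletCharacter (ZMod p) (d * (NumberField.discr K).natAbs)) ∅ 1‖ = 1)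
    (hD1 : ‖characterLValueD p (changeLevel (dvd_mul_right m (NumberField.discr K).natAbs) φ *
          changeLevel (dvd_mul_left (NumberField.discr K).natAbs m)
            (χ.ringHomComp (Int.castRingHom (ZMod p))) :
        DirichletCharacter (ZMod p) (m * (NumberField.discr K).natAbs)) ∅ 1‖ = 1)
    (n : ℕ) (hbal : n + ∑ v ∈ S₀, delta W p v =
      ∑ v ∈ S₀, ((if φ (Rat.HeightOneSpectrum.natGenerator v : ZMod m) =
            (Rat.HeightOneSpectrum.natGenerator v : ZMod p)
          then sFactor p (Rat.HeightOneSpectrum.natGenerator v) else 0) +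
        (if ψ (Rat.HeightOneSpectrum.natGenerator v : ZMod d) =
            (Rat.HeightOneSpectrum.natGenerator v : ZMod p)
          then sFactor p (Rat.HeightOneSpectrum.natGenerator v) else 0)))
    (Wd : WeierstrassCurve ℚ) [Wd.IsElliptic] [Wd.IsGloballyMinimal]
    (C : VariableChange ℚ) (hC : C • Wd = W.quadraticTwist (NumberField.discr K : ℚ)) :
    ∃ (V' : WeierstrassCurve ℚ) (_ : V'.IsElliptic) (_ : V'.IsGloballyMinimal), IsIsogenous Wd V' ∧
      ∃ (S₀' : Finset (HeightOneSpectrum (𝓞 ℚ))) (Φ' : AddSubgroup (V'.geomTorsion (p : ℤ)))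
        (m' : ℕ) (_ : NeZero m') (φ' : DirichletCharacter (ZMod p) m')
        (d' : ℕ) (_ : NeZero d') (ψ' : DirichletCharacter (ZMod p) d'),
        IsRationalLine V' p Φ' ∧ ¬ LineUnramifiedAt V' p Φ' ∧ LineEven V' p Φ' ∧
        φ'.IsPrimitive ∧ ψ'.IsPrimitive ∧ p ∣ m' ∧ ¬ p ∣ d' ∧
        (∀ (σ : absoluteGaloisGroup ℚ), ∀ Q ∈ Φ',
          σ • Q = (φ' ((modNCyclotomicCharacter ℚ m' σ : (ZMod m')ˣ) : ZMod m')).val • Q) ∧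
        (∀ (σ : absoluteGaloisGroup ℚ) (Q : V'.geomTorsion (p : ℤ)),
          σ • Q - (ψ' ((modNCyclotomicCharacter ℚ d' σ : (ZMod d')ˣ) : ZMod d')).val • Q ∈ Φ') ∧
        (∀ v ∈ S₀', ((p : ℕ) : 𝓞 ℚ) ∉ v.asIdeal) ∧
        (∀ v : HeightOneSpectrum (𝓞 ℚ), v ∉ S₀' → ((p : ℕ) : 𝓞 ℚ) ∉ v.asIdeal →
          V'.HasGoodReductionAt v) ∧
        ‖characterLValueC p φ' ∅ 1‖ = 1 ∧ ‖characterLValueD p ψ' ∅ 1‖ = 1 ∧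
        n + ∑ v ∈ S₀', delta V' p v =
          ∑ v ∈ S₀', ((if φ' (Rat.HeightOneSpectrum.natGenerator v : ZMod m') =
                (Rat.HeightOneSpectrum.natGenerator v : ZMod p)
              then sFactor p (Rat.HeightOneSpectrum.natGenerator v) else 0) +
            (if ψ' (Rat.HeightOneSpectrum.natGenerator v : ZMod d') =
                (Rat.HeightOneSpectrum.natGenerator v : ZMod p)
              then sFactor p (Rat.HeightOneSpectrum.natGenerator v) else 0)) := by
  have hpP : p.Prime := Fact.out
  have h2 : Module.finrank ℚ K = 2 := hK.1
  have hDneg : NumberField.discr K < 0 := hK.discr_neg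
  obtain ⟨hD4, hsqN⟩ := discr_emod_four_eq_one_and_squarefree_natAbs_of_odd h2 hodd
  -- `p` splits in `K`, so `p ∤ d_K`
  have hpD : ¬ (p : ℤ) ∣ NumberField.discr K :=
    Literature.SatisfiesHeegnerHypothesis.not_dvd_discr h2 hHp hpP dvd_rfl
  -- `χ` IS part 3's Jacobi character
  obtain ⟨χ', hχ2, hχp, hχJ', hχrad⟩ := exists_quadraticChar_geomSqrt_of_emod_four (p := p) hp2 hD4 hsqN
  obtain rfl : χ = χ' := mulChar_eq_of_forall_natCast fun a ↦ by rw [hχJ, hχJ']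
  -- the twist is multiplicative at `p` (`p` splits in `K`), so part 2's door form applies, Tate facts discharged
  have hmultd : Wd.HasMultiplicativeReductionAtPrime p :=
    X2.hasMultiplicativeReductionAtPrime_of_smul_eq_quadraticTwist W Wd hC p hp2 hpD hmult
  obtain ⟨V', hV', hV'min, hiso, Φ', hline, hramV, hevV, hprimψ, hprimφ, hpdN, hpmN, hψ0', hφ0'⟩ :=
    exists_isogenous_twistLine_ramifiedEven_characters (W := W) (Wd := Wd)
      Literature.NumberTheory.EllipticCurves.TateCurve.Silverman1994_thmV53_tateUniformisation_holds
      Literature.NumberTheory.EllipticCurves.TateCurve.Silverman1994_thmV53_corV54_tateUniformisation_holds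
      hp2 hDneg hpD χ hχ2 hχrad hχp hΦ hunr hevenL φ ψ hφ hψ hpm hpd hmD hdD hφ0 hψ0 hmultd C hC
  -- the places of `d_K` (part 1 §1)
  obtain ⟨T, hT, hST, hTD, hTp, hTS, hTcop, hTp'⟩ := exists_places_discr h2 hpP hpD hHN S₀ hS₀N
  have hTgood : ∀ v ∈ T, W.HasGoodReductionAt v := fun v hv ↦ hS v (hTS v hv) (hTp v hv)
  have hχ1 : ∀ v ∈ S₀, χ (Rat.HeightOneSpectrum.natGenerator v : ZMod (NumberField.discr K).natAbs) = 1 :=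
    fun v hv ↦ chi_natCast_eq_one_of_heegner' h2 hD4 hHN χ hχJ
      (Rat.HeightOneSpectrum.prime_natGenerator v) (hS₀N v hv)
  -- the balance of `W` with the two indicators swapped
  have hbal' : n + ∑ v ∈ S₀, delta W p v =
      ∑ v ∈ S₀, ((if ψ (Rat.HeightOneSpectrum.natGenerator v : ZMod d) =
            (Rat.HeightOneSpectrum.natGenerator v : ZMod p)
          then sFactor p (Rat.HeightOneSpectrum.natGenerator v) else 0) +
        (if φ (Rat.HeightOneSpectrum.natGenerator v : ZMod m) =
            (Rat.HeightOneSpectrum.natGenerator v : ZMod p)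
          then sFactor p (Rat.HeightOneSpectrum.natGenerator v) else 0)) := by
    rw [hbal]
    exact Finset.sum_congr rfl fun v _ ↦ add_comm _ _
  haveI := hV'
  haveI := hV'min
  refine ⟨V', hV', hV'min, hiso, S₀ ∪ T, Φ',
    d * (NumberField.discr K).natAbs, inferInstance, _, m * (NumberField.discr K).natAbs, inferInstance, _,
    hline, hramV, hevV, hprimψ, hprimφ, hpdN, hpmN, hψ0', hφ0', ?_, ?_, hC1, hD1, ?_⟩
  · -- `p ∉ S₀ ∪ T`
    exact fun v hv ↦ (Finset.mem_union.mp hv).elim (hS₀p v) (hTp v)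
  · -- `V′` is good off `S₀ ∪ T ∪ {p}`: `Wd` is (§1), and good reduction is an isogeny invariant
    intro v hv hpv
    rw [Finset.mem_union, not_or] at hv
    have hvD : ¬ ((Rat.HeightOneSpectrum.natGenerator v : ℕ) : ℤ) ∣ NumberField.discr K :=
      fun h ↦ hv.2 ((hT v).mpr (Int.natCast_dvd.mp h))
    exact (hiso.hasGoodReductionAt_iff_of_isIsogenous v).mp
      (hasGoodReductionAt_of_smul_eq_quadraticTwist hD4 C hC v hvD (hS v hv.1 hpv))
  · -- the balance over `S₀ ∪ T`: `δ_{V′} = δ_{Wd}` (§1), then «c(E^K) = c(E)» (part 4)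
    have hδ : ∑ v ∈ S₀ ∪ T, delta V' p v = ∑ v ∈ S₀ ∪ T, delta Wd p v :=
      Finset.sum_congr rfl fun v _ ↦ delta_eq_of_isIsogenous hiso p v
    rw [hδ]
    exact (balance_union_iff ψ φ _ _ S₀ T hST
      (fun v hv ↦ delta_twist_eq_of_heegner W K p h2 hHN v (hS₀N v hv) C hC)
      (fun v hv ↦ delta_twist_eq_zero_of_dvd_discr W K p h2 v (hTD v hv) (hTgood v hv) C hC)
      (fun v hv ↦ twistChar_natCast_of_apply_eq_one ψ χ (hχ1 v hv))
      (fun v hv ↦ twistChar_natCast_of_apply_eq_one φ χ (hχ1 v hv))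
      (fun v hv ↦ twistChar_natCast_of_not_coprime ψ χ (hTcop v hv))
      (fun v hv ↦ twistChar_natCast_of_not_coprime φ χ (hTcop v hv)) hTp' n).mpr hbal'

/-! ## §2. The composition: stub 6's conclusion at a non-split X2b pair from the `W`-side data -/

/-- **Stub 6's conclusion AT a NON-split X2b pair `(W, p)` from the `W`-SIDE DATA, FIRST X2b SHAPE** (the rational
line of `W` RAMIFIED at `p` and ODD, primitive characters `φ` mod `m ∋ p`, `ψ` mod `d ∌ p`): the door
`upperPartner_at_of_klFlat_partner` (p645525 §3, VERBATIM conclusion) with its carrier clause `hKL` DISCHARGED by part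
1's `klFlatCarrier_twist_of_lineRamifiedOdd`. Per-pair inputs that remain: ONE admissible `K` (imaginary quadratic,
Heegner for `N_W` and `p`, `d_K` odd `< −4`, `r_an(W^{(d_K)}) = 1`), the two units `‖L_∅(C,0)‖ = 1` of `φχ̄_K`
(mod `m|d_K|`) and `‖L_∅(D,0)‖ = 1` of `ψχ̄_K` (mod `d|d_K|`), and the balance `1 + Σ_{S₀} δ_W = Σ_{S₀} s([φ=ℓ̄]+[ψ=ℓ̄])`
over a set `S₀ ∌ (p)` of bad places of `W` off which `W` is good («c(E) = 1») — statements about `E` and `K` ONLY.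
Conditional on the named facts `PublishedInputs`, Disegni Thm. 4(1), GV Thm. (3.11); no summit statement / main
conjecture / BSD is proved; the EXISTENCE of such `K` is not proved here (Kriz–Li 2019 §4, to be typed).
[cite: GreenbergVatsal2000, Thm. (1.3), §2 p. 28, §3 Thm. (3.11) p. 43 and (28)] [cite: Disegni2020, Thm. 4 (§3.2)]
[cite: Wuthrich2014, Thm. 16 (p. 397)] [cite: SilvermanAEC2009, X.5 Cor. 5.4] [cite: KrizLi2019, §4 (the supply of K; not used)] -/
theorem upperPartner_at_of_klFlat_twist_of_lineRamifiedOdd (hP : EisensteinPrimes.PublishedInputs)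
    (hDis : padicBSD_rankOne_nonsplitMult) (h311 : thm311_hasUnitContent_iff_and_order_eq_of_lineRamifiedEven)
    (W : WeierstrassCurve ℚ) [W.IsElliptic] [W.IsGloballyMinimal] (p : ℕ) [Fact p.Prime]
    (hc : X2.CellB W p) (hns : ¬ W.HasSplitMultiplicativeReductionAtPrime p)
    (K : Type) [Field K] [NumberField K] (hK : IsImaginaryQuadratic K)
    (hHN : SatisfiesHeegnerHypothesis (W.conductorNorm ℤ) K) (hHp : SatisfiesHeegnerHypothesis p K)
    (hodd : Odd (NumberField.discr K)) (hlt : NumberField.discr K < -4)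
    (hr1 : (W.quadraticTwist (NumberField.discr K : ℚ)).analyticRank = 1)
    [NeZero (NumberField.discr K).natAbs] (χ : MulChar (ZMod (NumberField.discr K).natAbs) ℤ)
    (hχJ : ∀ a : ℕ, χ (a : ZMod (NumberField.discr K).natAbs) = J((a : ℤ) | (NumberField.discr K).natAbs))
    {Φ₀ : AddSubgroup (geomTorsion W (p : ℤ))} (hΦ : IsRationalLine W p Φ₀)
    (hram : ¬ LineUnramifiedAt W p Φ₀) (hoddL : LineOdd W p Φ₀)
    {m : ℕ} [NeZero m] (φ : DirichletCharacter (ZMod p) m) {d : ℕ} [NeZero d]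
    (ψ : DirichletCharacter (ZMod p) d) (hφ : φ.IsPrimitive) (hψ : ψ.IsPrimitive) (hpm : p ∣ m)
    (hpd : ¬ p ∣ d)
    (hmD : m.Coprime (NumberField.discr K).natAbs) (hdD : d.Coprime (NumberField.discr K).natAbs)
    (hφ0 : ∀ (σ : absoluteGaloisGroup ℚ), ∀ P ∈ Φ₀,
      σ • P = (φ ((modNCyclotomicCharacter ℚ m σ : (ZMod m)ˣ) : ZMod m)).val • P)
    (hψ0 : ∀ (σ : absoluteGaloisGroup ℚ) (P : geomTorsion W (p : ℤ)),
      σ • P - (ψ ((modNCyclotomicCharacter ℚ d σ : (ZMod d)ˣ) : ZMod d)).val • P ∈ Φ₀)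
    (S₀ : Finset (HeightOneSpectrum (𝓞 ℚ))) (hS₀p : ∀ v ∈ S₀, ((p : ℕ) : 𝓞 ℚ) ∉ v.asIdeal)
    (hS₀N : ∀ v ∈ S₀, Rat.HeightOneSpectrum.natGenerator v ∣ W.conductorNorm ℤ)
    (hS : ∀ v : HeightOneSpectrum (𝓞 ℚ), v ∉ S₀ → ((p : ℕ) : 𝓞 ℚ) ∉ v.asIdeal → W.HasGoodReductionAt v)
    (hC1 : ‖characterLValueC p (changeLevel (dvd_mul_right m (NumberField.discr K).natAbs) φ *
          changeLevel (dvd_mul_left (NumberField.discr K).natAbs m)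
            (χ.ringHomComp (Int.castRingHom (ZMod p))) :
        DirichletCharacter (ZMod p) (m * (NumberField.discr K).natAbs)) ∅ 1‖ = 1)
    (hD1 : ‖characterLValueD p (changeLevel (dvd_mul_right d (NumberField.discr K).natAbs) ψ *
          changeLevel (dvd_mul_left (NumberField.discr K).natAbs d)
            (χ.ringHomComp (Int.castRingHom (ZMod p))) :
        DirichletCharacter (ZMod p) (d * (NumberField.discr K).natAbs)) ∅ 1‖ = 1)
    (hbal : 1 + ∑ v ∈ S₀, delta W p v =
      ∑ v ∈ S₀, ((if φ (Rat.HeightOneSpectrum.natGenerator v : ZMod m) =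
            (Rat.HeightOneSpectrum.natGenerator v : ZMod p)
          then sFactor p (Rat.HeightOneSpectrum.natGenerator v) else 0) +
        (if ψ (Rat.HeightOneSpectrum.natGenerator v : ZMod d) =
            (Rat.HeightOneSpectrum.natGenerator v : ZMod p)
          then sFactor p (Rat.HeightOneSpectrum.natGenerator v) else 0))) :
    ∃ (K : Type) (_ : Field K) (_ : NumberField K), IsImaginaryQuadratic K ∧
      SatisfiesHeegnerHypothesis (W.conductorNorm ℤ) K ∧ SatisfiesHeegnerHypothesis p K ∧
      Odd (NumberField.discr K) ∧ NumberField.discr K < -4 ∧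
      (W.quadraticTwist (NumberField.discr K : ℚ)).analyticRank = 1 ∧
      ∀ (Wd : WeierstrassCurve ℚ) [Wd.IsElliptic] [Wd.IsGloballyMinimal],
        (∃ C : VariableChange ℚ, C • Wd = W.quadraticTwist (NumberField.discr K : ℚ)) →
        MissingUpperBoundAt Wd p :=
  upperPartner_at_of_klFlat_partner hP hDis h311 W p hc hns K hK hHN hHp hodd hlt hr1 fun Wd _ _ hWd ↦ by
    obtain ⟨C, hC⟩ := hWd
    exact klFlatCarrier_twist_of_lineRamifiedOdd W hc.2.1.1 K hK hodd hHN hHp χ hχJ hΦ hram hoddL φ ψ hφ hψ hpm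
      hpd hmD hdD hφ0 hψ0 S₀ hS₀p hS₀N hS hC1 hD1 1 hbal Wd C hC

/-- **Stub 6's conclusion AT a NON-split X2b pair `(W, p)` from the `W`-SIDE DATA, SECOND X2b SHAPE** (the rational
line of `W` UNRAMIFIED at `p` and EVEN, primitive characters `φ` mod `m ∌ p`, `ψ` mod `d ∋ p`; the units are read at
`ψχ̄_K` (for `L_∅(C,0)`) and `φχ̄_K` (for `L_∅(D,0)`)): the door `upperPartner_at_of_klFlat_partner` (VERBATIM
conclusion) with `hKL` DISCHARGED by §1's `klFlatCarrier_twist_of_lineUnramifiedEven` (carrier `Wd/Ψ₀`; `W` is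
multiplicative at `p` by `X2.CellB`). Same honest framing as the first shape.
[cite: GreenbergVatsal2000, Thm. (1.3), §2 p. 28, §3 Thm. (3.11) p. 43 and (28)] [cite: Disegni2020, Thm. 4 (§3.2)]
[cite: Wuthrich2014, Thm. 16 (p. 397)] [cite: SilvermanATAEC1994, Thm. V.5.3, Cor. V.5.4] [cite: KrizLi2019, §4 (the supply of K; not used)] -/
theorem upperPartner_at_of_klFlat_twist_of_lineUnramifiedEven (hP : EisensteinPrimes.PublishedInputs)
    (hDis : padicBSD_rankOne_nonsplitMult) (h311 : thm311_hasUnitContent_iff_and_order_eq_of_lineRamifiedEven)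
    (W : WeierstrassCurve ℚ) [W.IsElliptic] [W.IsGloballyMinimal] (p : ℕ) [Fact p.Prime]
    (hc : X2.CellB W p) (hns : ¬ W.HasSplitMultiplicativeReductionAtPrime p)
    (K : Type) [Field K] [NumberField K] (hK : IsImaginaryQuadratic K)
    (hHN : SatisfiesHeegnerHypothesis (W.conductorNorm ℤ) K) (hHp : SatisfiesHeegnerHypothesis p K)
    (hodd : Odd (NumberField.discr K)) (hlt : NumberField.discr K < -4)
    (hr1 : (W.quadraticTwist (NumberField.discr K : ℚ)).analyticRank = 1)
    [NeZero (NumberField.discr K).natAbs] (χ : MulChar (ZMod (NumberField.discr K).natAbs) ℤ)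
    (hχJ : ∀ a : ℕ, χ (a : ZMod (NumberField.discr K).natAbs) = J((a : ℤ) | (NumberField.discr K).natAbs))
    {Φ₀ : AddSubgroup (geomTorsion W (p : ℤ))} (hΦ : IsRationalLine W p Φ₀)
    (hunr : LineUnramifiedAt W p Φ₀) (hevenL : LineEven W p Φ₀)
    {m : ℕ} [NeZero m] (φ : DirichletCharacter (ZMod p) m) {d : ℕ} [NeZero d]
    (ψ : DirichletCharacter (ZMod p) d) (hφ : φ.IsPrimitive) (hψ : ψ.IsPrimitive) (hpm : ¬ p ∣ m)
    (hpd : p ∣ d)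
    (hmD : m.Coprime (NumberField.discr K).natAbs) (hdD : d.Coprime (NumberField.discr K).natAbs)
    (hφ0 : ∀ (σ : absoluteGaloisGroup ℚ), ∀ P ∈ Φ₀,
      σ • P = (φ ((modNCyclotomicCharacter ℚ m σ : (ZMod m)ˣ) : ZMod m)).val • P)
    (hψ0 : ∀ (σ : absoluteGaloisGroup ℚ) (P : geomTorsion W (p : ℤ)),
      σ • P - (ψ ((modNCyclotomicCharacter ℚ d σ : (ZMod d)ˣ) : ZMod d)).val • P ∈ Φ₀)
    (S₀ : Finset (HeightOneSpectrum (𝓞 ℚ))) (hS₀p : ∀ v ∈ S₀, ((p : ℕ) : 𝓞 ℚ) ∉ v.asIdeal)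
    (hS₀N : ∀ v ∈ S₀, Rat.HeightOneSpectrum.natGenerator v ∣ W.conductorNorm ℤ)
    (hS : ∀ v : HeightOneSpectrum (𝓞 ℚ), v ∉ S₀ → ((p : ℕ) : 𝓞 ℚ) ∉ v.asIdeal → W.HasGoodReductionAt v)
    (hC1 : ‖characterLValueC p (changeLevel (dvd_mul_right d (NumberField.discr K).natAbs) ψ *
          changeLevel (dvd_mul_left (NumberField.discr K).natAbs d)
            (χ.ringHomComp (Int.castRingHom (ZMod p))) :
        DirichletCharacter (ZMod p) (d * (NumberField.discr K).natAbs)) ∅ 1‖ = 1)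
    (hD1 : ‖characterLValueD p (changeLevel (dvd_mul_right m (NumberField.discr K).natAbs) φ *
          changeLevel (dvd_mul_left (NumberField.discr K).natAbs m)
            (χ.ringHomComp (Int.castRingHom (ZMod p))) :
        DirichletCharacter (ZMod p) (m * (NumberField.discr K).natAbs)) ∅ 1‖ = 1)
    (hbal : 1 + ∑ v ∈ S₀, delta W p v =
      ∑ v ∈ S₀, ((if φ (Rat.HeightOneSpectrum.natGenerator v : ZMod m) =
            (Rat.HeightOneSpectrum.natGenerator v : ZMod p)
          then sFactor p (Rat.HeightOneSpectrum.natGenerator v) else 0) +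
        (if ψ (Rat.HeightOneSpectrum.natGenerator v : ZMod d) =
            (Rat.HeightOneSpectrum.natGenerator v : ZMod p)
          then sFactor p (Rat.HeightOneSpectrum.natGenerator v) else 0))) :
    ∃ (K : Type) (_ : Field K) (_ : NumberField K), IsImaginaryQuadratic K ∧
      SatisfiesHeegnerHypothesis (W.conductorNorm ℤ) K ∧ SatisfiesHeegnerHypothesis p K ∧
      Odd (NumberField.discr K) ∧ NumberField.discr K < -4 ∧
      (W.quadraticTwist (NumberField.discr K : ℚ)).analyticRank = 1 ∧
      ∀ (Wd : WeierstrassCurve ℚ) [Wd.IsElliptic] [Wd.IsGloballyMinimal],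
        (∃ C : VariableChange ℚ, C • Wd = W.quadraticTwist (NumberField.discr K : ℚ)) →
        MissingUpperBoundAt Wd p :=
  upperPartner_at_of_klFlat_partner hP hDis h311 W p hc hns K hK hHN hHp hodd hlt hr1 fun Wd _ _ hWd ↦ by
    obtain ⟨C, hC⟩ := hWd
    exact klFlatCarrier_twist_of_lineUnramifiedEven W hc.2.1.1 hc.2.1.2.2 K hK hodd hHN hHp χ hχJ hΦ hunr hevenL
      φ ψ hφ hψ hpm hpd hmD hdD hφ0 hψ0 S₀ hS₀p hS₀N hS hC1 hD1 1 hbal Wd C hC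

end Summit.BirchSwinnertonDyer.BirchSwinnertonDyer.Theorems.EisensteinPrimesMazurMCOnCellBTwistbackTwistDoorIsogenous

end
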